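import Literature.Geometry.Manifold.ShuffleCubeMaps
import Literature.LinearAlgebra.Alternating.ShuffleBlockVectors
import Mathlib.Analysis.Calculus.LineDeriv.Basic
import Mathlib.Analysis.Calculus.Deriv.Prod
import Mathlib.Analysis.Calculus.Deriv.Pi
import Mathlib.Analysis.Calculus.Deriv.Mul
import Mathlib.Analysis.Calculus.Deriv.Comp
import Mathlib.Analysis.Calculus.Deriv.Add
import Mathlib.Analysis.Calculus.Deriv.Shift
import Mathlib.Analysis.Normed.Module.Alternating.Basic
import HarnessLib

/-!
# The cube maps of a shuffle simplex: cone recursion of the points and of the tangent columns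

Topic `Literature/Geometry/Manifold`. For a tuple of lattice points `w` the shuffle simplex
`(σ,τ)_w` of two simplices is, in cube coordinates, `(σ.cubeMap ∘ S_w, τ.cubeMap ∘ T_w)`
(`…Manifold.ShuffleCubeMaps`, `…Manifold.ShuffleSimplexCube`); write
`Φ_w = (S_w, T_w) : ℝⁿ → ℝᵖ × ℝ^q` (`Phi`). Integrating an `n`-form over `(σ,τ)_w` means
integrating `t ↦ Ω(Φ_w t)(∂₀Φ_w(t), …, ∂_{n-1}Φ_w(t))` (`shuffleIntegrand`) for the pulled-back
form `Ω`. This file proves the **cone recursion of the integrand**: after an initial right-step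
(`w = (o, R₀ ∘ v)`), at the point `(t₀, t')`,

* `Φ_w(t₀, t') = hR t₀ (Φ_v t')` (`Phi_consR`),
* `∂₀Φ_w = cR (T_v t')` and `∂_{i+1}Φ_w = LR t₀ (∂ᵢΦ_v(t'))` (`fderiv_Phi_consR_zero/succ`),

so that `shuffleIntegrand Ω w (t₀,t') = shuffleIntegrand (ΩR t₀ Ω) v t'` for the **transported
form** `ΩR t₀ Ω (x) = Ω(hR t₀ x)(cR x₂, LR t₀ –)` (`shuffleIntegrand_consR`), and symmetrically for
an initial up-step (`…_consU`, `ΩU`). Together with the block-frame identities of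
`…Alternating.ShuffleBlockVectors` and the cube Fubini lemmas of `…Manifold.CubeFubini` this
drives the inductive evaluation of the shuffle sum of integrals (`…Manifold.ShuffleFubini`).
Derivatives are computed as line derivatives (`DifferentiableAt.lineDeriv_eq_fderiv`) of the
polynomial map `Φ_w` along coordinate lines, on which the cone maps are affine.

Everything is proved; no named facts.

## References

* S. Eilenberg, S. Mac Lane, On the groups `H(Π,n)`. I, Ann. of Math. 58 (1953), §5. [folklore attribution]
-/

noncomputable section

open Set Function Literature.LinearAlgebra.Alternating
open Literature.AlgebraicTopology.SingularHomology Literature.AlgebraicTopology.SingularHomology.ShuffleChains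

namespace Literature.Geometry.Manifold

variable {F : Type*} [NormedAddCommGroup F] [NormedSpace ℝ F] {n : ℕ}

/-! ### The pair of cube maps -/

/-- The pair of cube maps of a tuple: `Φ_w t = (S_w t, T_w t)`. [folklore] -/
def Phi (p q : ℕ) (w : Fin (n + 1) → V) (t : Fin n → ℝ) : X p q := (cubeS p w t, cubeT q w t)

/-- `Φ_w` is polynomial, hence `C^∞`. [folklore] -/
theorem contDiff_Phi {m : WithTop ℕ∞} (p q : ℕ) (w : Fin (n + 1) → V) : ContDiff ℝ m (Phi p q w) :=
  (contDiff_cubeS p w).prodMk (contDiff_cubeT q w)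

/-- `Φ_w` is differentiable. [folklore] -/
theorem differentiable_Phi (p q : ℕ) (w : Fin (n + 1) → V) : Differentiable ℝ (Phi p q w) :=
  (contDiff_Phi (m := 1) p q w).differentiable one_ne_zero

/-- `Φ_w` is continuous. [folklore] -/
theorem continuous_Phi (p q : ℕ) (w : Fin (n + 1) → V) : Continuous (Phi p q w) :=
  (contDiff_Phi (m := 0) p q w).continuous

/-- `Φ_w` maps the cube into the product of cubes. [folklore] -/
theorem Phi_mem_prod (p q : ℕ) (w : Fin (n + 1) → V) {t : Fin n → ℝ} (ht : t ∈ Icc (0 : Fin n → ℝ) 1) :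
    Phi p q w t ∈ Icc (0 : Fin p → ℝ) 1 ×ˢ Icc (0 : Fin q → ℝ) 1 :=
  ⟨cubeS_mem_unitCube p w ht, cubeT_mem_unitCube q w ht⟩

/-! ### Cone recursion of the points -/

/-- **After an initial right-step, `Φ_w(t₀,t') = hR t₀ (Φ_v t')`.** [folklore] -/
theorem Phi_consR (p q : ℕ) (v : Fin (n + 1) → V) (t₀ : ℝ) (t' : Fin n → ℝ) :
    Phi (p + 1) q (Fin.cons o (faceR 0 ∘ v) : Fin (n + 2) → V) (Fin.cons t₀ t') = hR p q t₀ (Phi p q v t') := by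
  simp only [Phi, hR]
  refine Prod.ext ?_ ?_
  · rw [cubeS_consR]; rfl
  · cases q with
    | zero => exact funext fun j ↦ j.elim0
    | succ q' =>
      rw [cubeT_consR]
      change Fin.cons (t₀ * cubeT (q' + 1) v t' 0) (Fin.tail (cubeT (q' + 1) v t')) = scaleFirst t₀ (cubeT (q' + 1) v t')
      conv_rhs => rw [← Fin.cons_self_tail (cubeT (q' + 1) v t'), scaleFirst_cons]

/-- **After an initial up-step, `Φ_w(t₀,t') = hU t₀ (Φ_v t')`.** [folklore] -/
theorem Phi_consU (p q : ℕ) (v : Fin (n + 1) → V) (t₀ : ℝ) (t' : Fin n → ℝ) :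
    Phi p (q + 1) (Fin.cons o (faceU 0 ∘ v) : Fin (n + 2) → V) (Fin.cons t₀ t') = hU p q t₀ (Phi p q v t') := by
  simp only [Phi, hU]
  refine Prod.ext ?_ ?_
  · cases p with
    | zero => exact funext fun j ↦ j.elim0
    | succ p' =>
      rw [cubeS_consU]
      change Fin.cons (t₀ * cubeS (p' + 1) v t' 0) (Fin.tail (cubeS (p' + 1) v t')) = scaleFirst t₀ (cubeS (p' + 1) v t')
      conv_rhs => rw [← Fin.cons_self_tail (cubeS (p' + 1) v t'), scaleFirst_cons]
  · rw [cubeT_consU]; rfl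

/-! ### Derivatives of the cone maps along the cone parameter -/

/-- `cons s y = cons 0 y + s • e₀`. [folklore] -/
theorem cons_eq_add_smul_single {p : ℕ} (s : ℝ) (y : Fin p → ℝ) :
    (Fin.cons s y : Fin (p + 1) → ℝ) = Fin.cons 0 y + s • (Pi.single 0 1 : Fin (p + 1) → ℝ) := by
  funext j
  refine Fin.cases (by simp) (fun j' ↦ ?_) j
  simp [Fin.succ_ne_zero]

/-- `scaleFirst s y = (0, y_{≥1}) + s • (y₀, 0, …)`. [folklore] -/
theorem scaleFirst_eq_add_smul {q : ℕ} (s : ℝ) (y : Fin q → ℝ) :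
    scaleFirst s y = (fun j : Fin q ↦ if (j : ℕ) = 0 then 0 else y j) + s • fun j : Fin q ↦ if (j : ℕ) = 0 then y j else 0 := by
  funext j
  simp only [scaleFirst_apply, Pi.add_apply, Pi.smul_apply, smul_eq_mul]
  split_ifs <;> ring

/-- The right-step cone map is affine in the cone parameter with derivative `cR`. [folklore] -/
theorem hasDerivAt_hR (p q : ℕ) (y : X p q) (s : ℝ) : HasDerivAt (fun s ↦ hR p q s y) (cR p q y.2) s := by
  have h1 : HasDerivAt (fun s : ℝ ↦ (Fin.cons s y.1 : Fin (p + 1) → ℝ)) (Pi.single 0 1) s := by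
    have heq : (fun s : ℝ ↦ (Fin.cons s y.1 : Fin (p + 1) → ℝ)) = fun s ↦ Fin.cons 0 y.1 + s • (Pi.single 0 1 : Fin (p + 1) → ℝ) :=
      funext fun s ↦ cons_eq_add_smul_single s y.1
    rw [heq]
    have h := ((hasDerivAt_id s).smul_const (Pi.single (0 : Fin (p + 1)) (1 : ℝ))).const_add (Fin.cons 0 y.1 : Fin (p + 1) → ℝ)
    simpa using h
  have h2 : HasDerivAt (fun s : ℝ ↦ scaleFirst s y.2) (fun j : Fin q ↦ if (j : ℕ) = 0 then y.2 j else 0) s := by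
    have heq : (fun s : ℝ ↦ scaleFirst s y.2) = fun s ↦ (fun j : Fin q ↦ if (j : ℕ) = 0 then 0 else y.2 j) +
        s • fun j : Fin q ↦ if (j : ℕ) = 0 then y.2 j else 0 := funext fun s ↦ scaleFirst_eq_add_smul s y.2
    rw [heq]
    have h := ((hasDerivAt_id s).smul_const (fun j : Fin q ↦ if (j : ℕ) = 0 then y.2 j else 0)).const_add
      (fun j : Fin q ↦ if (j : ℕ) = 0 then 0 else y.2 j)
    simpa using h
  exact h1.prodMk h2

/-- The up-step cone map is affine in the cone parameter with derivative `cU`. [folklore] -/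
theorem hasDerivAt_hU (p q : ℕ) (y : X p q) (s : ℝ) : HasDerivAt (fun s ↦ hU p q s y) (cU p q y.1) s := by
  have h1 : HasDerivAt (fun s : ℝ ↦ scaleFirst s y.1) (fun j : Fin p ↦ if (j : ℕ) = 0 then y.1 j else 0) s := by
    have heq : (fun s : ℝ ↦ scaleFirst s y.1) = fun s ↦ (fun j : Fin p ↦ if (j : ℕ) = 0 then 0 else y.1 j) +
        s • fun j : Fin p ↦ if (j : ℕ) = 0 then y.1 j else 0 := funext fun s ↦ scaleFirst_eq_add_smul s y.1
    rw [heq]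
    have h := ((hasDerivAt_id s).smul_const (fun j : Fin p ↦ if (j : ℕ) = 0 then y.1 j else 0)).const_add
      (fun j : Fin p ↦ if (j : ℕ) = 0 then 0 else y.1 j)
    simpa using h
  have h2 : HasDerivAt (fun s : ℝ ↦ (Fin.cons s y.2 : Fin (q + 1) → ℝ)) (Pi.single 0 1) s := by
    have heq : (fun s : ℝ ↦ (Fin.cons s y.2 : Fin (q + 1) → ℝ)) = fun s ↦ Fin.cons 0 y.2 + s • (Pi.single 0 1 : Fin (q + 1) → ℝ) :=
      funext fun s ↦ cons_eq_add_smul_single s y.2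
    rw [heq]
    have h := ((hasDerivAt_id s).smul_const (Pi.single (0 : Fin (q + 1)) (1 : ℝ))).const_add (Fin.cons 0 y.2 : Fin (q + 1) → ℝ)
    simpa using h
  exact h1.prodMk h2

/-! ### Cone recursion of the tangent columns -/

/-- Moving along `e₀` from `(t₀, t')` changes only the cone parameter. [folklore] -/
theorem cons_add_smul_single_zero (t₀ r : ℝ) (t' : Fin n → ℝ) :
    (Fin.cons t₀ t' : Fin (n + 1) → ℝ) + r • Pi.single 0 1 = Fin.cons (t₀ + r) t' := by
  funext j
  refine Fin.cases (by simp) (fun j' ↦ ?_) j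
  simp [Fin.succ_ne_zero]

/-- Moving along `e_{i+1}` from `(t₀, t')` moves `t'` along `eᵢ`. [folklore] -/
theorem cons_add_smul_single_succ (t₀ r : ℝ) (t' : Fin n → ℝ) (i : Fin n) :
    (Fin.cons t₀ t' : Fin (n + 1) → ℝ) + r • Pi.single i.succ 1 =
      (Fin.cons t₀ (t' + r • Pi.single i 1 : Fin n → ℝ) : Fin (n + 1) → ℝ) := by
  funext j
  refine Fin.cases (by simp [(Fin.succ_ne_zero i).symm]) (fun j' ↦ ?_) j
  simp [Pi.single_apply, Fin.succ_inj]

/-- A derivative is the line derivative. [folklore] -/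
theorem fderiv_apply_eq_deriv_line {E : Type*} [NormedAddCommGroup E] [NormedSpace ℝ E] {G : Type*}
    [NormedAddCommGroup G] [NormedSpace ℝ G] {f : E → G} {x : E} (hf : DifferentiableAt ℝ f x) (v : E) :
    fderiv ℝ f x v = deriv (fun r : ℝ ↦ f (x + r • v)) 0 := by
  rw [← hf.lineDeriv_eq_fderiv]
  rfl

/-- **Right-step, column `0`**: `∂₀Φ_w(t₀,t') = cR (T_v t')`. [folklore] -/
theorem fderiv_Phi_consR_zero (p q : ℕ) (v : Fin (n + 1) → V) (t₀ : ℝ) (t' : Fin n → ℝ) :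
    fderiv ℝ (Phi (p + 1) q (Fin.cons o (faceR 0 ∘ v) : Fin (n + 2) → V)) (Fin.cons t₀ t') (Pi.single 0 1) =
      cR p q (cubeT q v t') := by
  rw [fderiv_apply_eq_deriv_line ((differentiable_Phi _ _ _) _)]
  simp only [cons_add_smul_single_zero, Phi_consR]
  exact (HasDerivAt.comp_const_add t₀ 0 (hasDerivAt_hR p q (Phi p q v t') (t₀ + 0))).deriv

/-- **Right-step, columns `≥ 1`**: `∂_{i+1}Φ_w(t₀,t') = LR t₀ (∂ᵢΦ_v(t'))`. [folklore] -/
theorem fderiv_Phi_consR_succ (p q : ℕ) (v : Fin (n + 1) → V) (t₀ : ℝ) (t' : Fin n → ℝ) (i : Fin n) :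
    fderiv ℝ (Phi (p + 1) q (Fin.cons o (faceR 0 ∘ v) : Fin (n + 2) → V)) (Fin.cons t₀ t') (Pi.single i.succ 1) =
      LRL p q t₀ (fderiv ℝ (Phi p q v) t' (Pi.single i 1)) := by
  rw [fderiv_apply_eq_deriv_line ((differentiable_Phi _ _ _) _),
    fderiv_apply_eq_deriv_line ((differentiable_Phi _ _ _) _)]
  simp only [cons_add_smul_single_succ, Phi_consR, hR_eq]
  have hg : HasDerivAt (fun r : ℝ ↦ Phi p q v (t' + r • Pi.single i 1))
      (deriv (fun r : ℝ ↦ Phi p q v (t' + r • Pi.single i 1)) 0) 0 := by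
    refine DifferentiableAt.hasDerivAt ?_
    exact ((differentiable_Phi p q v) _).comp _ ((differentiableAt_const _).add ((differentiableAt_id).smul_const _))
  exact (((LRL p q t₀).hasFDerivAt.comp_hasDerivAt 0 hg).const_add _).deriv

/-- **Up-step, column `0`**: `∂₀Φ_w(t₀,t') = cU (S_v t')`. [folklore] -/
theorem fderiv_Phi_consU_zero (p q : ℕ) (v : Fin (n + 1) → V) (t₀ : ℝ) (t' : Fin n → ℝ) :
    fderiv ℝ (Phi p (q + 1) (Fin.cons o (faceU 0 ∘ v) : Fin (n + 2) → V)) (Fin.cons t₀ t') (Pi.single 0 1) =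
      cU p q (cubeS p v t') := by
  rw [fderiv_apply_eq_deriv_line ((differentiable_Phi _ _ _) _)]
  simp only [cons_add_smul_single_zero, Phi_consU]
  exact (HasDerivAt.comp_const_add t₀ 0 (hasDerivAt_hU p q (Phi p q v t') (t₀ + 0))).deriv

/-- **Up-step, columns `≥ 1`**: `∂_{i+1}Φ_w(t₀,t') = LU t₀ (∂ᵢΦ_v(t'))`. [folklore] -/
theorem fderiv_Phi_consU_succ (p q : ℕ) (v : Fin (n + 1) → V) (t₀ : ℝ) (t' : Fin n → ℝ) (i : Fin n) :
    fderiv ℝ (Phi p (q + 1) (Fin.cons o (faceU 0 ∘ v) : Fin (n + 2) → V)) (Fin.cons t₀ t') (Pi.single i.succ 1) =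
      LUL p q t₀ (fderiv ℝ (Phi p q v) t' (Pi.single i 1)) := by
  rw [fderiv_apply_eq_deriv_line ((differentiable_Phi _ _ _) _),
    fderiv_apply_eq_deriv_line ((differentiable_Phi _ _ _) _)]
  simp only [cons_add_smul_single_succ, Phi_consU, hU_eq]
  have hg : HasDerivAt (fun r : ℝ ↦ Phi p q v (t' + r • Pi.single i 1))
      (deriv (fun r : ℝ ↦ Phi p q v (t' + r • Pi.single i 1)) 0) 0 := by
    refine DifferentiableAt.hasDerivAt ?_
    exact ((differentiable_Phi p q v) _).comp _ ((differentiableAt_const _).add ((differentiableAt_id).smul_const _))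
  exact (((LUL p q t₀).hasFDerivAt.comp_hasDerivAt 0 hg).const_add _).deriv

/-! ### The shuffle integrand and the transported forms -/

/-- **The shuffle integrand** of an alternating-map-valued function `Ω` along the tuple `w`:
`t ↦ Ω(Φ_w t)(∂₀Φ_w(t), …, ∂_{n-1}Φ_w(t))`. [folklore] -/
def shuffleIntegrand (p q : ℕ) (Ω : X p q → X p q [⋀^Fin n]→L[ℝ] F) (w : Fin (n + 1) → V) (t : Fin n → ℝ) : F :=
  Ω (Phi p q w t) fun i ↦ fderiv ℝ (Phi p q w) t (Pi.single i 1)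

/-- **The right-transported form** `ΩR t₀ Ω (x) = Ω(hR t₀ x)(cR x₂, LR t₀ –)`. [folklore] -/
def OmegaR (p q : ℕ) (t₀ : ℝ) (Ω : X (p + 1) q → X (p + 1) q [⋀^Fin (n + 1)]→L[ℝ] F) (x : X p q) :
    X p q [⋀^Fin n]→L[ℝ] F :=
  ((Ω (hR p q t₀ x)).curryLeft (cR p q x.2)).compContinuousLinearMap (LRL p q t₀)

/-- **The up-transported form** `ΩU t₀ Ω (x) = Ω(hU t₀ x)(cU x₁, LU t₀ –)`. [folklore] -/
def OmegaU (p q : ℕ) (t₀ : ℝ) (Ω : X p (q + 1) → X p (q + 1) [⋀^Fin (n + 1)]→L[ℝ] F) (x : X p q) :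
    X p q [⋀^Fin n]→L[ℝ] F :=
  ((Ω (hU p q t₀ x)).curryLeft (cU p q x.1)).compContinuousLinearMap (LUL p q t₀)

/-- Unfolding `ΩR`. [folklore] -/
theorem OmegaR_apply (p q : ℕ) (t₀ : ℝ) (Ω : X (p + 1) q → X (p + 1) q [⋀^Fin (n + 1)]→L[ℝ] F) (x : X p q)
    (u : Fin n → X p q) : OmegaR p q t₀ Ω x u = Ω (hR p q t₀ x) (Fin.cons (cR p q x.2) fun i ↦ LRL p q t₀ (u i)) := by
  simp only [OmegaR, ContinuousAlternatingMap.compContinuousLinearMap_apply, ContinuousAlternatingMap.curryLeft_apply_apply]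
  rfl

/-- Unfolding `ΩU`. [folklore] -/
theorem OmegaU_apply (p q : ℕ) (t₀ : ℝ) (Ω : X p (q + 1) → X p (q + 1) [⋀^Fin (n + 1)]→L[ℝ] F) (x : X p q)
    (u : Fin n → X p q) : OmegaU p q t₀ Ω x u = Ω (hU p q t₀ x) (Fin.cons (cU p q x.1) fun i ↦ LUL p q t₀ (u i)) := by
  simp only [OmegaU, ContinuousAlternatingMap.compContinuousLinearMap_apply, ContinuousAlternatingMap.curryLeft_apply_apply]
  rfl

/-- **Cone recursion of the integrand, right-step**:
`shuffleIntegrand Ω (o, R₀∘v) (t₀, t') = shuffleIntegrand (ΩR t₀ Ω) v t'`. [folklore] -/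
theorem shuffleIntegrand_consR (p q : ℕ) (Ω : X (p + 1) q → X (p + 1) q [⋀^Fin (n + 1)]→L[ℝ] F)
    (v : Fin (n + 1) → V) (t₀ : ℝ) (t' : Fin n → ℝ) :
    shuffleIntegrand (p + 1) q Ω (Fin.cons o (faceR 0 ∘ v)) (Fin.cons t₀ t') = shuffleIntegrand p q (OmegaR p q t₀ Ω) v t' := by
  rw [shuffleIntegrand, shuffleIntegrand, OmegaR_apply, Phi_consR]
  congr 1
  rw [← Fin.cons_self_tail (fun i : Fin (n + 1) ↦
    fderiv ℝ (Phi (p + 1) q (Fin.cons o (faceR 0 ∘ v) : Fin (n + 2) → V)) (Fin.cons t₀ t') (Pi.single i 1))]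
  congr 1
  · exact fderiv_Phi_consR_zero p q v t₀ t'
  · funext i
    exact fderiv_Phi_consR_succ p q v t₀ t' i

/-- **Cone recursion of the integrand, up-step**:
`shuffleIntegrand Ω (o, U₀∘v) (t₀, t') = shuffleIntegrand (ΩU t₀ Ω) v t'`. [folklore] -/
theorem shuffleIntegrand_consU (p q : ℕ) (Ω : X p (q + 1) → X p (q + 1) [⋀^Fin (n + 1)]→L[ℝ] F)
    (v : Fin (n + 1) → V) (t₀ : ℝ) (t' : Fin n → ℝ) :
    shuffleIntegrand p (q + 1) Ω (Fin.cons o (faceU 0 ∘ v)) (Fin.cons t₀ t') = shuffleIntegrand p q (OmegaU p q t₀ Ω) v t' := by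
  rw [shuffleIntegrand, shuffleIntegrand, OmegaU_apply, Phi_consU]
  congr 1
  rw [← Fin.cons_self_tail (fun i : Fin (n + 1) ↦
    fderiv ℝ (Phi p (q + 1) (Fin.cons o (faceU 0 ∘ v) : Fin (n + 2) → V)) (Fin.cons t₀ t') (Pi.single i 1))]
  congr 1
  · exact fderiv_Phi_consU_zero p q v t₀ t'
  · funext i
    exact fderiv_Phi_consU_succ p q v t₀ t' i

/-! ### Continuity -/

/-- The shuffle integrand of a continuous `Ω` is continuous. [folklore] -/
theorem continuous_shuffleIntegrand (p q : ℕ) {Ω : X p q → X p q [⋀^Fin n]→L[ℝ] F} (hΩ : Continuous Ω)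
    (w : Fin (n + 1) → V) : Continuous (shuffleIntegrand p q Ω w) := by
  unfold shuffleIntegrand
  have h1 : Continuous fun t ↦ Ω (Phi p q w t) := hΩ.comp (continuous_Phi p q w)
  have h2 : Continuous fun t ↦ fun i ↦ fderiv ℝ (Phi p q w) t (Pi.single i 1) :=
    continuous_pi fun i ↦ ((contDiff_Phi (m := 1) p q w).continuous_fderiv one_ne_zero).clm_apply continuous_const
  exact h1.eval h2

/-- The right-transported form of a continuous `Ω` is continuous. [folklore] -/
theorem continuous_OmegaR (p q : ℕ) (t₀ : ℝ) {Ω : X (p + 1) q → X (p + 1) q [⋀^Fin (n + 1)]→L[ℝ] F}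
    (hΩ : Continuous Ω) : Continuous (OmegaR p q t₀ Ω) := by
  unfold OmegaR
  refine (ContinuousAlternatingMap.compContinuousLinearMapCLM (LRL p q t₀)).continuous.comp ?_
  have hc : Continuous fun x : X p q ↦ cR p q x.2 := by
    refine continuous_const.prodMk (continuous_pi fun j ↦ ?_)
    by_cases hj : (j : ℕ) = 0
    · simp only [hj, if_true]; exact (continuous_apply j).comp continuous_snd
    · simp only [hj, if_false]; exact continuous_const
  exact ((ContinuousAlternatingMap.curryLeftLI (𝕜 := ℝ)).continuous.comp (hΩ.comp (continuous_hR p q t₀))).clm_apply hc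

/-- The up-transported form of a continuous `Ω` is continuous. [folklore] -/
theorem continuous_OmegaU (p q : ℕ) (t₀ : ℝ) {Ω : X p (q + 1) → X p (q + 1) [⋀^Fin (n + 1)]→L[ℝ] F}
    (hΩ : Continuous Ω) : Continuous (OmegaU p q t₀ Ω) := by
  unfold OmegaU
  refine (ContinuousAlternatingMap.compContinuousLinearMapCLM (LUL p q t₀)).continuous.comp ?_
  have hc : Continuous fun x : X p q ↦ cU p q x.1 := by
    refine (continuous_pi fun a ↦ ?_).prodMk continuous_const
    by_cases ha : (a : ℕ) = 0
    · simp only [ha, if_true]; exact (continuous_apply a).comp continuous_fst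
    · simp only [ha, if_false]; exact continuous_const
  exact ((ContinuousAlternatingMap.curryLeftLI (𝕜 := ℝ)).continuous.comp (hΩ.comp (continuous_hU p q t₀))).clm_apply hc

end Literature.Geometry.Manifold
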